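import Summits.MatrixMultiplication.OmegaCensus.STPPVosperSlackFourCell22SoundTools
import Summits.MatrixMultiplication.OmegaCensus.STPPVosperSlackTwoSoundG
import Summits.MatrixMultiplication.OmegaCensus.STPPVosperSlackTwoChain

/-!
# ω-census (abelian STPP census): SOUNDNESS of the cell-(2,2) checker — the normal form is contradictory (kernel tool)

HONEST FRAMING (pub-omega census; verbatim): lottery ticket; floor = certified bounds/negative ranges.
Census STRUCTURE (seat pub-omega-stpp-2 gen 28, 2026-08-29), family (b2).  For the structure-free cell of the slack-4 law on the fifth ℤ₆₁ leaf
(`STPPVosperSlackFourLawT.lean`, hypothesis `h22`; checker `STPPVosperSlackFourCell22Checker.lean`):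

* `c22_false_of_normal_form` : an STPP family of `ℤ/p` (non-empty blocks) whose block `i` has `|Cᵢ| = 3`, `Σ_{k≠i}|A_k||C_k| = Σ_{k≠i}|B_k||C_k| = 13`,
  value lists `P` of `Aᵢ` and `Q` of `Bᵢ`, whose three sets `W`, `SY = −Aᵢ + Y°`, `T = −Bᵢ + Z°` cover `ℤ/p` (the exact partition of cell (2,2)), with
  `SY`-mask `S` and `T`-mask `rot p (dilRunsMask p u rs) s` (`s < p`, run lengths `≤ 17`, `(dilRunsMask p u rs, rs)` among the listed `T`-shapes), and a
  table of pairs all `CoverDead`, makes the row `c22CheckS p u P Q S tsh tbl = true` impossible.  Steps: the pattern `P + Q` is duplicate-free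
  (`add_injOn_AB`); the shift `s` is not forbidden (prefix-union semantics `tb_c22Prefix_getD`, `tb_c22Forb`; `SY ∩ T = ∅`); at the leaf the mask
  `univ ∖ (S ∪ T)` IS `W`, every `c ∈ Cᵢ` is a candidate translate and the three of them tile `W` exactly (`blockSum`), the sorted value lists of `Y°`, `Z°`
  are 13-sublists of the candidate masks with the exact sumsets (`tb_foldl_lor_rot_maskOf`), so the leaf puts `(Yo, Zo)` in the dead table — contradiction.
(mask lemmas in `STPPVosperSlackFourCell22SoundTools.lean`).
UNCONDITIONAL; no `decide`.  Nothing here is progress on `ω`.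

References: H. Cohn, R. Kleinberg, B. Szegedy, C. Umans, FOCS 2005 (arXiv:math/0511460), Def. 5.1.
-/

open Finset
open scoped Pointwise

namespace Summit.MatrixMultiplication.OmegaCensus.CubeNB.S2

open Literature.Computability.AlgebraicComplexity
open Literature.Combinatorics.Additive
open Summit.MatrixMultiplication.OmegaCensus.STPPKneser
open Summit.MatrixMultiplication.OmegaCensus.CubeNB.Bits

/-! ## §2 The normal form is contradictory -/

/-- **SOUNDNESS of the cell-(2,2) checker in normal form.**  See the module docstring. [cite: CohnKleinbergSzegedyUmans2005, Def. 5.1] -/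
theorem c22_false_of_normal_form {p : ℕ} [hp : Fact p.Prime] {N : ℕ} {A B C : Fin N → Finset (ZMod p)} (hS : IsSTPP A B C)
    (hA : ∀ k, (A k).Nonempty) (hB : ∀ k, (B k).Nonempty) (hC : ∀ k, (C k).Nonempty) (i : Fin N)
    (hc : #(C i) = 3) (hz : ∑ k ∈ univ.erase i, #(A k) * #(C k) = 13) (hL : ∑ k ∈ univ.erase i, #(B k) * #(C k) = 13)
    (P Q : List ℕ) (hPmem : ∀ v, v ∈ P ↔ ∃ x ∈ A i, x.val = v) (hPnd : P.Nodup) (hQmem : ∀ v, v ∈ Q ↔ ∃ x ∈ B i, x.val = v)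
    (hQnd : Q.Nodup) {S T : ℕ} (hSY : ∀ v, tb S v = true ↔ ∃ e ∈ (A i).image (fun x => (0 : ZMod p) - x) + DU B C (univ.erase i), e.val = v)
    (hT : ∀ v, tb T v = true ↔ ∃ e ∈ (B i).image (fun x => (0 : ZMod p) - x) + DU A C (univ.erase i), e.val = v)
    (hpart : (((A i) ×ˢ ((B i) ×ˢ (C i))).image fun q : ZMod p × ZMod p × ZMod p => (0 : ZMod p) + q.2.2 - q.1 - q.2.1) ∪
        ((A i).image (fun x => (0 : ZMod p) - x) + DU B C (univ.erase i)) ∪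
        ((B i).image (fun x => (0 : ZMod p) - x) + DU A C (univ.erase i)) = univ)
    {u s : ℕ} {rs : List (ℕ × ℕ)} (hs : s < p) (hTrot : T = rot p (dilRunsMask p u rs) s) (hrs : ∀ r ∈ rs, r.2 ≤ 17)
    {tsh : List (ℕ × List (ℕ × ℕ))} (he : (dilRunsMask p u rs, rs) ∈ tsh)
    (ks : List (Fin N)) (hks : ks.Nodup) (hksi : ∀ k, k ∈ ks ↔ k ≠ i) {szs : List (ℕ × ℕ × ℕ)}
    (hszs : ks.map (fun k => (#(A k), #(B k), #(C k))) = szs)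
    {tbl : List (List ℕ × List ℕ)} (hdead : ∀ e ∈ tbl, CoverDead p N i szs e.1 e.2)
    (hrow : c22CheckS p u P Q S tsh tbl = true) : False := by
  have hp0 : 0 < p := hp.out.pos
  have hQlt : ∀ q ∈ Q, q < p := fun q hq => by obtain ⟨x, _, rfl⟩ := (hQmem q).1 hq; exact x.val_lt
  have hPlt : ∀ q ∈ P, q < p := fun q hq => by obtain ⟨x, _, rfl⟩ := (hPmem q).1 hq; exact x.val_lt
  -- the three sets
  set W := ((A i) ×ˢ ((B i) ×ˢ (C i))).image fun q : ZMod p × ZMod p × ZMod p => (0 : ZMod p) + q.2.2 - q.1 - q.2.1 with hW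
  set SY := (A i).image (fun x => (0 : ZMod p) - x) + DU B C (univ.erase i) with hSYdef
  set TT := (B i).image (fun x => (0 : ZMod p) - x) + DU A C (univ.erase i) with hTT
  have hWSY : Disjoint W SY := disjoint_W_negA_add_DU hS i
  have hTWSY : Disjoint TT (W ∪ SY) := disjoint_negB_add_DU_AC hS i
  have hmemW : ∀ x ∈ A i, ∀ b ∈ B i, ∀ cc ∈ C i, cc - x - b ∈ W := fun x hx b hb cc hcc =>
    mem_image.2 ⟨(x, b, cc), mem_product.2 ⟨hx, mem_product.2 ⟨hb, hcc⟩⟩, by ring⟩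
  have hSlt : S < 2 ^ p := lt_two_pow_of_tb fun v hv => by obtain ⟨e, _, rfl⟩ := (hSY v).1 hv; exact e.val_lt
  have hTlt : T < 2 ^ p := lt_two_pow_of_tb fun v hv => by obtain ⟨e, _, rfl⟩ := (hT v).1 hv; exact e.val_lt
  -- the pattern is duplicate-free
  set patt := pattPQ p P Q with hpattdef
  have hpatt_mem : ∀ w, w ∈ patt ↔ ∃ x ∈ A i, ∃ bb ∈ B i, (x.val + bb.val) % p = w := by
    intro w; rw [hpattdef, pattPQ, List.mem_flatMap]
    constructor
    · rintro ⟨xv, hxv, hw⟩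
      rw [List.mem_map] at hw
      obtain ⟨q, hq, rfl⟩ := hw
      obtain ⟨x, hx, rfl⟩ := (hPmem xv).1 hxv
      obtain ⟨bb, hbb, rfl⟩ := (hQmem q).1 hq; exact ⟨x, hx, bb, hbb, rfl⟩
    · rintro ⟨x, hx, bb, hbb, rfl⟩
      exact ⟨x.val, (hPmem _).2 ⟨x, hx, rfl⟩, List.mem_map.2 ⟨bb.val, (hQmem _).2 ⟨bb, hbb, rfl⟩, rfl⟩⟩
  have hpatt_cast : ∀ (x bb : ZMod p), ((((x.val + bb.val) % p : ℕ)) : ZMod p) = x + bb := fun x bb => by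
    rw [cast_add_mod, ZMod.natCast_zmod_val, ZMod.natCast_zmod_val]
  have hpatt : patt.Nodup := by
    rw [hpattdef, pattPQ, List.nodup_flatMap]
    constructor
    · intro xv _
      refine List.Nodup.map_on (fun q hq q' hq' hqq => ?_) hQnd
      have hq1 := hQlt q hq
      have hq2 := hQlt q' hq'
      have := congrArg (fun n : ℕ => (n : ZMod p)) hqq
      simp only [cast_add_mod, add_right_inj] at this
      have := congrArg ZMod.val this
      rwa [ZMod.val_natCast_of_lt hq1, ZMod.val_natCast_of_lt hq2] at this
    · refine hPnd.imp_of_mem ?_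
      intro xv xv' hxv hxv' hne v hv hv'
      rw [List.mem_map] at hv hv'
      obtain ⟨q, hq, rfl⟩ := hv
      obtain ⟨q', hq', hqq⟩ := hv'
      obtain ⟨x, hx, rfl⟩ := (hPmem xv).1 hxv
      obtain ⟨x', hx', rfl⟩ := (hPmem xv').1 hxv'
      obtain ⟨bb, hbb, rfl⟩ := (hQmem q).1 hq
      obtain ⟨bb', hbb', rfl⟩ := (hQmem q').1 hq'
      have hcast := congrArg (fun n : ℕ => (n : ZMod p)) hqq
      simp only [hpatt_cast] at hcast
      obtain ⟨hxx, -⟩ := add_injOn_AB hS hC i hx' hx hbb' hbb hcast; exact hne (by rw [hxx])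
  have hpatt_lt : ∀ d ∈ patt, d < p := fun d hd => by
    obtain ⟨x, _, bb, _, rfl⟩ := (hpatt_mem d).1 hd; exact Nat.mod_lt _ hp0
  -- the row reaches our `T`-shape
  have hplace := c22Place_of_c22CheckS hrow hpatt he
  set negD := maskOf (patt.map fun d => (p - d) % p) with hnegD
  have hnegD_lt : negD < 2 ^ p := maskOf_lt_two_pow fun v hv => by
    obtain ⟨d, _, rfl⟩ := List.mem_map.1 hv; exact Nat.mod_lt _ hp0
  -- the shift `s` is not forbidden: `SY ∩ T = ∅`
  have hfree : tb (c22Forb p u (c22Prefix p u S) rs) s = false := by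
    rw [Bool.eq_false_iff]
    intro hforb
    obtain ⟨r, hr, hbit⟩ := tb_c22Forb hp0 (fun n => c22Prefix_getD_lt p u S n) hs hforb
    have hm18 : r.2 < 18 := by have := hrs r hr; omega
    obtain ⟨j, hj, hSbit⟩ := tb_c22Prefix_getD hp0 hSlt hm18 (Nat.mod_lt _ hp0) hbit
    rw [Nat.mod_add_mod] at hSbit
    obtain ⟨e, heSY, hev⟩ := (hSY _).1 hSbit
    set a := u * r.1 with ha
    set b := u * j with hb
    have htbT : tb T ((s + a + b) % p) = true := by
      rw [hTrot, tb_rot (dilRunsMask_lt hp0 rs) hs.le (Nat.mod_lt _ hp0), tb_dilRunsMask]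
      refine ⟨r, hr, j, hj, ?_⟩
      have h1 : (s + a + b) % p + p - s = (s + a + b) % p + (p - s) := by omega
      have h2 : ((s + a + b) % p + (p - s)) % p = (a + b) % p := by
        rw [Nat.add_mod ((s + a + b) % p) (p - s) p, Nat.mod_mod, ← Nat.add_mod, show s + a + b + (p - s) = a + b + p by omega,
          Nat.add_mod_right]
      rw [Nat.mul_add, ← ha, ← hb, h1, h2]
    obtain ⟨e', heT, hev'⟩ := (hT _).1 htbT
    have hee : e = e' := ZMod.val_injective p (hev.trans hev'.symm)
    rw [hee] at heSY
    exact Finset.disjoint_left.1 hTWSY heT (mem_union_right _ heSY)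
  -- the leaf at `(S, T)`
  have hleaf : c22Leaf p P Q patt negD S T tbl = true := by
    have h := c22Leaf_of_c22Place hplace hs hfree
    rw [← hTrot] at h; exact h
  unfold c22Leaf at hleaf
  dsimp only at hleaf
  set Wm := fullMask p ^^^ (S ||| T) with hWm
  have hWm_lt : Wm < 2 ^ p := by
    rw [hWm, fullMask_eq]; exact Nat.xor_lt_two_pow (by have := Nat.one_le_two_pow (n := p); omega) (Nat.or_lt_two_pow hSlt hTlt)
  -- `Wm` is the mask of `W`
  have hSfalse : ∀ w ∈ W, tb S w.val = false := fun w hw => by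
    rw [Bool.eq_false_iff]; intro h
    obtain ⟨e, he, hev⟩ := (hSY _).1 h
    rw [ZMod.val_injective p hev] at he
    exact Finset.disjoint_left.1 hWSY hw he
  have hTfalse : ∀ w ∈ W, tb T w.val = false := fun w hw => by
    rw [Bool.eq_false_iff]; intro h
    obtain ⟨e, he, hev⟩ := (hT _).1 h
    rw [ZMod.val_injective p hev] at he
    exact Finset.disjoint_left.1 hTWSY he (mem_union_left _ hw)
  have htbWm : ∀ v, tb Wm v = true ↔ ∃ w ∈ W, w.val = v := by
    intro v
    constructor
    · intro h
      have hv : v < p := by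
        by_contra hv'
        rw [tb_eq_false_of_lt hWm_lt (not_lt.1 hv')] at h; exact Bool.noConfusion h
      rw [hWm, tb_compl hv, tb_lor] at h
      have hSv : tb S v = false := by cases hh : tb S v <;> simp [hh] at h ⊢
      have hTv : tb T v = false := by cases hh : tb T v <;> simp [hh, hSv] at h ⊢
      have hmem : ((v : ℕ) : ZMod p) ∈ W ∪ SY ∪ TT := by rw [hpart]; exact mem_univ _
      have hval : (((v : ℕ) : ZMod p)).val = v := ZMod.val_cast_of_lt hv
      rcases mem_union.1 hmem with hmem | hmem
      · rcases mem_union.1 hmem with hmem | hmem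
        · exact ⟨_, hmem, hval⟩
        · have := (hSY v).2 ⟨_, hmem, hval⟩; rw [hSv] at this; exact absurd this Bool.false_ne_true
      · have := (hT v).2 ⟨_, hmem, hval⟩; rw [hTv] at this; exact absurd this Bool.false_ne_true
    · rintro ⟨w, hw, rfl⟩
      rw [hWm, tb_compl w.val_lt, tb_lor, hSfalse w hw, hTfalse w hw]; rfl
  -- every `c ∈ Cᵢ` is a candidate translate
  set cc := patt.foldl (fun m d => m &&& rot p Wm d) (fullMask p) with hcc
  have hval_sub : ∀ (c₀ x bb : ZMod p), (c₀ - x - bb).val = (c₀.val + p - (x.val + bb.val) % p) % p := fun c₀ x bb => by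
    have h := cast_add_sub_mod (p := p) (u := c₀.val) (v := (x.val + bb.val) % p) (by have := Nat.mod_lt (x.val + bb.val) hp0; omega)
    have h' := congrArg ZMod.val h
    rw [ZMod.val_natCast, Nat.mod_eq_of_lt (Nat.mod_lt _ hp0), ZMod.natCast_zmod_val, hpatt_cast] at h'
    rw [h']; congr 1; ring
  have htbcc : ∀ c₀ ∈ C i, tb cc c₀.val = true := by
    intro c₀ hc₀
    rw [hcc, tb_foldl_land_rot hWm_lt hpatt_lt c₀.val_lt]
    intro d hd
    obtain ⟨x, hx, bb, hbb, rfl⟩ := (hpatt_mem d).1 hd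
    rw [htbWm]
    exact ⟨c₀ - x - bb, hmemW x hx bb hbb c₀ hc₀, hval_sub c₀ x bb⟩
  set cs := members (List.range p) cc with hcs
  have hCmem : ∀ c₀ ∈ C i, c₀.val ∈ cs := fun c₀ hc₀ => mem_members.2 ⟨List.mem_range.2 c₀.val_lt, htbcc c₀ hc₀⟩
  have hcs_lt : ∀ c ∈ cs, c < p := fun c hcm => List.mem_range.1 (mem_members.1 hcm).1
  set c3 := cs.filter fun v => decide (v ∈ (C i).image ZMod.val) with hc3
  have hc3mem : c3 ∈ cs.sublistsLen 3 := by
    rw [← hc, ← card_image_of_injective (C i) (ZMod.val_injective p)]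
    exact filter_mem_sublistsLen _ (nodup_members List.nodup_range _) _ fun v hv => by
      obtain ⟨c₀, hc₀, rfl⟩ := mem_image.1 hv; exact hCmem c₀ hc₀
  have hc3_mem : ∀ c, c ∈ c3 ↔ ∃ c₀ ∈ C i, c₀.val = c := by
    intro c; rw [hc3, List.mem_filter, decide_eq_true_eq, mem_image]
    constructor
    · exact fun h => h.2
    · rintro ⟨c₀, hc₀, rfl⟩; exact ⟨hCmem c₀ hc₀, c₀, hc₀, rfl⟩
  -- first disjunct: no candidate at all
  rw [Bool.or_eq_true] at hleaf
  rcases hleaf with h0 | hleaf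
  · obtain ⟨c₀, hc₀⟩ := hC i
    have := htbcc c₀ hc₀
    rw [Nat.eq_of_beq_eq_true h0, tb_eq_testBit, Nat.zero_testBit] at this
    exact Bool.noConfusion this
  -- second: fewer than three candidates
  rw [Bool.or_eq_true] at hleaf
  rcases hleaf with h1 | hleaf
  · have hlen := (List.mem_sublistsLen.1 hc3mem).1.length_le
    rw [(List.mem_sublistsLen.1 hc3mem).2] at hlen
    rw [Bool.not_eq_true', Nat.ble_eq_true_of_le hlen] at h1
    exact Bool.noConfusion h1
  -- third: no exact tiling — but `Cᵢ` tiles `W`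
  rw [Bool.or_eq_true] at hleaf
  rcases hleaf with h2 | hleaf
  · rw [Bool.not_eq_true', List.any_eq_false] at h2
    apply h2 c3 hc3mem
    have heq : c3.foldl (fun m c => m ||| rot p negD c) 0 = Wm := by
      apply Nat.eq_of_testBit_eq
      intro v
      rw [← tb_eq_testBit, ← tb_eq_testBit, Bool.eq_iff_iff, tb_foldl_lor_fun, htbWm]
      constructor
      · rintro (h | ⟨c, hcm, h⟩)
        · rw [tb_eq_testBit, Nat.zero_testBit] at h; exact Bool.noConfusion h
        · obtain ⟨c₀, hc₀, rfl⟩ := (hc3_mem c).1 hcm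
          have hv : v < p := by
            by_contra hv'
            rw [tb_eq_false_of_lt (rot_lt_two_pow p negD _) (not_lt.1 hv')] at h; exact Bool.noConfusion h
          rw [tb_rot hnegD_lt c₀.val_lt.le hv, hnegD, tb_maskOf] at h
          obtain ⟨d, hd, hdv⟩ := List.mem_map.1 h
          obtain ⟨x, hx, bb, hbb, rfl⟩ := (hpatt_mem d).1 hd
          refine ⟨c₀ - x - bb, hmemW x hx bb hbb c₀ hc₀, ?_⟩
          have hcast : ((((p - (x.val + bb.val) % p) % p : ℕ)) : ZMod p) = ((((v + p - c₀.val) % p : ℕ)) : ZMod p) := by rw [hdv]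
          rw [cast_negMod (Nat.mod_lt _ hp0).le, hpatt_cast, cast_add_sub_mod (by have := c₀.val_lt; omega), ZMod.natCast_zmod_val] at hcast
          -- hcast : -(x + bb) = (v : ZMod p) - c₀
          have hv' : ((v : ℕ) : ZMod p) = c₀ - x - bb := by linear_combination (-1 : ZMod p) * hcast
          rw [← hv', ZMod.val_cast_of_lt hv]
      · rintro ⟨w, hw, rfl⟩
        obtain ⟨⟨x, bb, c₀⟩, hq, rfl⟩ := mem_image.1 hw
        simp only [mem_product] at hq
        obtain ⟨hx, hbb, hc₀⟩ := hq
        refine Or.inr ⟨c₀.val, (hc3_mem _).2 ⟨c₀, hc₀, rfl⟩, ?_⟩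
        have hwval : ((0 : ZMod p) + c₀ - x - bb).val < p := ZMod.val_lt _
        rw [tb_rot hnegD_lt c₀.val_lt.le hwval, hnegD, tb_maskOf]
        refine List.mem_map.2 ⟨(x.val + bb.val) % p, (hpatt_mem _).2 ⟨x, hx, bb, hbb, rfl⟩, ?_⟩
        -- both sides are `< p` and cast to the same element of `ZMod p`
        have h1 : (p - (x.val + bb.val) % p) % p < p := Nat.mod_lt _ hp0
        have h2 : (((0 : ZMod p) + c₀ - x - bb).val + p - c₀.val) % p < p := Nat.mod_lt _ hp0
        have hc : ((((p - (x.val + bb.val) % p) % p : ℕ)) : ZMod p) = (((((0 : ZMod p) + c₀ - x - bb).val + p - c₀.val) % p : ℕ) : ZMod p) := by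
          rw [cast_negMod (Nat.mod_lt _ hp0).le, hpatt_cast, cast_add_sub_mod (by have := c₀.val_lt; omega), ZMod.natCast_zmod_val,
            ZMod.natCast_zmod_val]; ring
        have := congrArg ZMod.val hc
        rwa [ZMod.val_cast_of_lt h1, ZMod.val_cast_of_lt h2] at this
    rw [heq]; exact Nat.beq_refl _
  -- fourth: the realisations `(Yo, Zo)` of our family are in the table
  rw [List.all_eq_true] at hleaf
  -- `Y°`
  set ycS := P.foldl (fun m x => m &&& rot p S x) (fullMask p) with hycS
  have hYc : ∀ y ∈ DU B C (univ.erase i), y.val ∈ members (List.range p) ycS := by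
    intro y hy
    rw [mem_members, List.mem_range]
    refine ⟨y.val_lt, ?_⟩
    rw [hycS, tb_foldl_land_rot hSlt hPlt y.val_lt]
    intro xv hxv
    obtain ⟨x, hx, rfl⟩ := (hPmem xv).1 hxv
    rw [hSY]
    refine ⟨(0 - x) + y, Finset.add_mem_add (mem_image.2 ⟨x, hx, rfl⟩) hy, ?_⟩
    have h := cast_add_sub_mod (p := p) (u := y.val) (v := x.val) (by have := x.val_lt; omega)
    have h' := congrArg ZMod.val h
    rw [ZMod.val_natCast, Nat.mod_eq_of_lt (Nat.mod_lt _ hp0), ZMod.natCast_zmod_val, ZMod.natCast_zmod_val] at h'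
    rw [h']; congr 1; ring
  set Yo := (members (List.range p) ycS).filter fun v => decide (v ∈ (DU B C (univ.erase i)).image ZMod.val) with hYo
  have hYcard : #(DU B C (univ.erase i)) = 13 := by rw [card_DU_BC hS hA, hL]
  have hYo13 : Yo ∈ (members (List.range p) ycS).sublistsLen 13 := by
    rw [← hYcard, ← card_image_of_injective (DU B C (univ.erase i)) (ZMod.val_injective p)]
    exact filter_mem_sublistsLen _ (nodup_members List.nodup_range _) _ fun v hv => by
      obtain ⟨y, hy, rfl⟩ := mem_image.1 hv; exact hYc y hy
  have hYo_mem : ∀ v, v ∈ Yo ↔ ∃ y ∈ DU B C (univ.erase i), y.val = v := by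
    intro v; rw [hYo, List.mem_filter, decide_eq_true_eq, mem_image]
    constructor
    · exact fun h => h.2
    · rintro ⟨y, hy, rfl⟩; exact ⟨hYc y hy, y, hy, rfl⟩
  have hYo_nd : Yo.Nodup := (nodup_members List.nodup_range _).filter _
  have hfoldY : P.foldl (fun m x => m ||| rot p (maskOf Yo) (p - x)) 0 = S := by
    apply Nat.eq_of_testBit_eq
    intro v
    rw [← tb_eq_testBit, ← tb_eq_testBit, Bool.eq_iff_iff, tb_foldl_lor_rot_maskOf hPmem hYo_mem v, hSY]
  have hY := hleaf Yo hYo13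
  rw [Bool.or_eq_true] at hY
  rcases hY with hY | hY
  · rw [hfoldY, Nat.beq_refl] at hY; exact Bool.noConfusion hY
  rw [List.all_eq_true] at hY
  -- `Z°`
  set zcT := Q.foldl (fun m q => m &&& rot p T q) (fullMask p) with hzcT
  have hZc : ∀ ζ ∈ DU A C (univ.erase i), ζ.val ∈ members (List.range p) zcT := by
    intro ζ hζ
    rw [mem_members, List.mem_range]
    refine ⟨ζ.val_lt, ?_⟩
    rw [hzcT, tb_foldl_land_rot hTlt hQlt ζ.val_lt]
    intro qv hqv
    obtain ⟨b, hb, rfl⟩ := (hQmem qv).1 hqv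
    rw [hT]
    refine ⟨(0 - b) + ζ, Finset.add_mem_add (mem_image.2 ⟨b, hb, rfl⟩) hζ, ?_⟩
    have h := cast_add_sub_mod (p := p) (u := ζ.val) (v := b.val) (by have := b.val_lt; omega)
    have h' := congrArg ZMod.val h
    rw [ZMod.val_natCast, Nat.mod_eq_of_lt (Nat.mod_lt _ hp0), ZMod.natCast_zmod_val, ZMod.natCast_zmod_val] at h'
    rw [h']; congr 1; ring
  set Zo := (members (List.range p) zcT).filter fun v => decide (v ∈ (DU A C (univ.erase i)).image ZMod.val) with hZo
  have hZcard : #(DU A C (univ.erase i)) = 13 := by rw [card_DU_AC hS hB, hz]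
  have hZo13 : Zo ∈ (members (List.range p) zcT).sublistsLen 13 := by
    rw [← hZcard, ← card_image_of_injective (DU A C (univ.erase i)) (ZMod.val_injective p)]
    exact filter_mem_sublistsLen _ (nodup_members List.nodup_range _) _ fun v hv => by
      obtain ⟨ζ, hζ, rfl⟩ := mem_image.1 hv; exact hZc ζ hζ
  have hZo_mem : ∀ v, v ∈ Zo ↔ ∃ ζ ∈ DU A C (univ.erase i), ζ.val = v := by
    intro v; rw [hZo, List.mem_filter, decide_eq_true_eq, mem_image]
    constructor
    · exact fun h => h.2
    · rintro ⟨ζ, hζ, rfl⟩; exact ⟨hZc ζ hζ, ζ, hζ, rfl⟩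
  have hZo_nd : Zo.Nodup := (nodup_members List.nodup_range _).filter _
  have hfoldZ : Q.foldl (fun m q => m ||| rot p (maskOf Zo) (p - q)) 0 = T := by
    apply Nat.eq_of_testBit_eq
    intro v
    rw [← tb_eq_testBit, ← tb_eq_testBit, Bool.eq_iff_iff, tb_foldl_lor_rot_maskOf hQmem hZo_mem v, hT]
  have hZ := hY Zo hZo13
  rw [Bool.or_eq_true] at hZ
  rcases hZ with hZ | hZ
  · rw [hfoldZ, Nat.beq_refl] at hZ; exact Bool.noConfusion hZ
  -- the table entry is dead for our family
  have hmem : (Yo, Zo) ∈ tbl := of_decide_eq_true hZ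
  exact hdead _ hmem A B C hS hA hB hC ks hks hksi hszs hYo_nd hZo_nd hYo_mem hZo_mem

end Summit.MatrixMultiplication.OmegaCensus.CubeNB.S2
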